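import Mathlib.Tactic.Linarith
import Mathlib.Tactic.LinearCombination
import Mathlib.Tactic.Ring
import Mathlib.Tactic.NormNum
import HarnessLib

/-!
# The (0,1) cell of the ι-window, EXISTENCE side, V: the rank-zero glued hulls and the closure of the flag `(β)‴`

Family `hodge`, layer `Literature/AlgebraicGeometry/HodgeTheory`. Companion to `SemiregularityGluedTangencyCensus.lean` (pv3-g11) with the
SAME dictionary: `X = J = J(C)`, `C` general of genus 4, `ι = −1`, a would-be `(0,1)` object `F = ker(E ↠ T)` of shape (4.5)(a) with flat
rank-2 hull `E`, `F' := ker(E ↠ T/T₀)`, `M := F'_x` at an `ι`-fixed point `x` of the glued support `S_b = (W₂ + a) ∪ (−W₂ − a)`, where the two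
smooth branches `Y₁`, `Y₂ = ιY₁` are tangent at `x` and meet along the excess curve `Γ`; `A = k[[x₄, m', u₁, u₂]]` (all `ι`-odd),
`I(Y₁) = (x₄, m' − G)`, `I(Y₂) = (x₄, m' + G)`, `q = m'² − G²`, `G` even square-free, `B = k[[m', u₁, u₂]]`, `R = A/(x₄, q) ⊂ R̃ = 𝒪_{Y₁} × 𝒪_{Y₂}`,
`𝔠 = G·R̃`; value matrix `Φ = [[s,t],[t^ι,s^ι]]`, `D = ss^ι − tt^ι`, `ρ = 1 ⟺ D|_Γ ≡ 0`; 'rank 0' = `x` is a base point of `𝔞₁ = (s,t)`.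
Ladder note `papers/HodgeConjecture/hodge-weil-ladder` (packet `run/shared/lean/b2b/hodge-weil/`), CLAIM TABLE v28 (LADDER C186) row pv3-g12,
report `b2b-hweil-pv3-g12/H2-EXISTENCE-SIDE-5.md`, scripts `code/pv3-g12/`. Def-free, fully proved ELEMENTARY statements (integer bookkeeping and
polynomial identities); the module theory and geometry are in the docstrings and the report. HONEST FRAMING: census / negative results about the
existence side of one cell of the ladder's H2 test; no case of the Hodge conjecture is proved; nothing here is a rung; no statement of
[Markman 2025] is used; nothing depends on (LP), on a transport of supports, or on the theta function.

(I) GENERAL STRUCTURE (report §1, any even square-free `G ∈ 𝔪²`). For a rank-0, `ρ = 1` datum: `M = M₀₀ + lifts(Sol)` with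
`Sol = {(w̄₁,w̄₂) ∈ 𝒪_Γ² : w̄₁t̄ = w̄₂s̄^ι, w̄₁s̄ = w̄₂t̄^ι}`; `M/𝓘_S E ≅ J := (R : G_x) = Hom_R(G_x, R)` (the R-dual of the hull image);
`W := M ∩ B² ⊇ qB²`, `W/qB² ≅ J`, and `W ⊗ k ≅ k²/⟨w¹(J)(0)⟩ ⊕ J ⊗ k`, so `μ(M) = 2 + μ_R(J) + δ`, `δ = 2 − dim⟨w¹(J)(0)⟩`; `pd_B W ≤ 1`, whence
`b(M) = (2 + μ', 2μ' − 2, μ' − 2)` (`rankZero_mappingCone_betti`) with signs `b₁^± = b₁^B(W)^± + b₀^B(W)^∓`, `b₂^± = b₁^B(W)^∓`; and if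
`t_x(M) = 0` and `W ⊗ k ∈ {(1,1),(2,1),(1,2),(2,2)}` the SIGNED shape is forced to be `(2,2;1,1)`, `(3,2;2,2;0,1)`, `(2,3;2,2;1,0)` or
`(3,3;3,3;1,1)` (`rankZero_shape_forcing`) — the shapes of pv3-g11's types IV-1 / II / II-mirror / IV-0, each closed by the census of
`SemiregularityGluedTangencyCensus.lean` (`betaPrime_typeI_counts`, `_typeII_counts`, `_typeIV0_counts`), whose inputs are the signed shape only.

(II) NODE-TYPE FIXED POINTS (report §2; `p ≠ q`, `Λ` base-point free, and — correcting pv3-g11 1.3 (b) — also the Weierstrass points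
`p = q`, `tangentCone_diagonalFixedPoint`): branch directions `κ_b(0) ∈ {(1,1),(1,−1)}` (`direction_lemma_arith`); `Sol = 𝒪_Γ κ̃` (equal
directions ⇒ TYPE V, `M = 𝓘_S E + Aη`, shape `(3,2;2,2;0,1)` or mirror — contains the square type) or `𝔪₁κ₁ ⊕ 𝔪₂κ₂` (mixed ⇒
`M = 𝓘_S E + Aη₁ + Aη₂`, `δ = 2 − #{b : ℓ_t + ε_bℓ_s ≠ 0}`: IV-1 / VI / VII, `node_mixed_rank`), all balanced (`node_sol_balance`); the
CLASSIFICATION `μ = 2 + μ_R(J) + δ ∈ {4,5,5,6}` (`node_type_table`) ⇒ THEOREM 2.7: `(β)‴` is CLOSED at node-type fixed points.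

(III) THE 24 `(T2)` POINTS (report §3; `Λ` with a base point: `Γ` reducible, an `ι`-swapped tacnode of contact 2, `G = u₁² − u₂⁴`;
`T2_configuration_count`): `Sol` is `ι`-induced (`y²κ₊𝒪 ⊕ y²κ₋𝒪`) or cyclic with unit generator; both closed ⇒ THEOREM 3.4: pv3-g11's
THEOREM (β)′ holds WITHOUT the flag `(β)‴` and without the base-point inventory: G73-a's existence side is EMPTY.

(IV) `(E2)(a)` (report §4): `h^i(C₂, 𝒪(x_p)) = (1,3,3)` by Künneth on `C × C` (`C2_xp_cohomology`) and
`𝒪(x_q + T_{|K−c'−q|}) = det (K − c')^{[2]}` has Serre dual `𝒪(x_{c'})`, so `(h⁰,h¹,h²) = (3,3,1)` identically (`C2_thetaClass_cohomology`):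
pv3-g11 7.3 (a)'s 'jump locus' premise is void; `(E2)` stays OPEN.

What is NOT here: the module-theoretic proofs (report §§1–3); anything about objects; any (LP) statement. 0 unconditional rungs above the floor.
-/

namespace Literature.AlgebraicGeometry.HodgeTheory

section H2GluedTangencyRankZero

/-- Mapping-cone Betti count (report 1.4): `W = M ∩ B²` has `pd_B W ≤ 1` and rank 2, so its B-resolution is
`0 → B^{μ'−2} → B^{μ'} → W → 0`; with `0 → x₄E → M → W → 0` and `Tor^A_i(k,W) = Tor^B_i ⊕ Tor^B_{i−1}` one gets
`b(M) = (2 + μ', 2μ' − 2, μ' − 2)`, of Euler characteristic `2 = rank M` for every `μ'`, and `(4,2,0)`, `(5,4,1)`, `(6,6,2)` for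
`μ' = 2, 3, 4` — the Betti numbers of pv3-g11's types IV-1, II, IV-0. [folklore] -/
theorem rankZero_mappingCone_betti :
    (∀ m : ℤ, (2 + m) - (2 * m - 2) + (m - 2) = 2) ∧
    ((2 + 2 = 4 ∧ 2 * 2 - 2 = 2 ∧ 2 - 2 = 0) ∧ (2 + 3 = 5 ∧ 2 * 3 - 2 = 4 ∧ 3 - 2 = 1) ∧
     (2 + 4 = 6 ∧ 2 * 4 - 2 = 6 ∧ 4 - 2 = 2)) := by
  refine ⟨?_, by norm_num⟩
  intro m
  ring

/-- Balance forces the signed shape (report 1.5). With `(w₊,w₋) = b₀^B(W)^±` and `(σ₊,σ₋) = b₁^B(W)^±` the signed Euler characteristic of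
`M` is `[(w₊+1) − (w₋+1)] − [(σ₊ + w₋) − (σ₋ + w₊)] + [σ₋ − σ₊] = 2(w₊ − w₋) − 2(σ₊ − σ₋)`; so `t_x(M) = 0` iff `σ₊ − σ₋ = w₊ − w₋`, and
for `W ⊗ k = (1,1), (2,1), (1,2), (2,2)` (with `σ₊ + σ₋ = μ' − 2 = 0, 1, 1, 2`) the relation signs are forced: `σ = (0,0), (1,0), (0,1), (1,1)`,
i.e. the signed shapes `(2,2;1,1)`, `(3,2;2,2;0,1)`, `(2,3;2,2;1,0)`, `(3,3;3,3;1,1)`. [folklore] -/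
theorem rankZero_shape_forcing :
    (∀ wp wm sp sm : ℤ,
      ((wp + 1) - (wm + 1)) - ((sp + wm) - (sm + wp)) + (sm - sp) = 2 * (wp - wm) - 2 * (sp - sm)) ∧
    (∀ sp sm : ℕ, sp + sm = 0 → (sp : ℤ) - sm = 1 - 1 → sp = 0 ∧ sm = 0) ∧
    (∀ sp sm : ℕ, sp + sm = 1 → (sp : ℤ) - sm = 2 - 1 → sp = 1 ∧ sm = 0) ∧
    (∀ sp sm : ℕ, sp + sm = 1 → (sp : ℤ) - sm = 1 - 2 → sp = 0 ∧ sm = 1) ∧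
    (∀ sp sm : ℕ, sp + sm = 2 → (sp : ℤ) - sm = 2 - 2 → sp = 1 ∧ sm = 1) := by
  refine ⟨?_, ?_, ?_, ?_, ?_⟩
  · intro wp wm sp sm
    ring
  all_goals
    intro sp sm h1 h2
    omega

/-- The direction lemma (report 2.1): the involution `T(w̄₁,w̄₂) = (−w̄₂^ι, −w̄₁^ι)` preserves each branch kernel line at an
`ι`-stable node, so the direction `(a, b)` of the line satisfies `(−b, −a) ∝ (a, b)`, i.e. `a² = b²`, i.e. `(a,b) ∝ (1, 1)` or `(1, −1)`.
[folklore] -/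
theorem direction_lemma_arith : ∀ a b : ℚ, a * a = b * b → a = b ∨ a = -b := by
  intro a b h
  exact mul_self_eq_mul_self_iff.mp h

/-- Balance at a node (report 2.5): in the mixed case `Sol ≅ 𝒪_{br₁}σ₁ ⊕ 𝒪_{br₂}σ₂` with eigen-generators of signs `ε₁ ≠ ε₂`,
`𝒪_{br} = A/(x₄, m', u_b)` (three odd generators: `t = (1+1)³ = 8`), so `t(Sol) = 8ε₁ + 8ε₂ = 0`; in the equal-directions case
`Sol ≅ 𝒪_Γ = A/(x₄, m', G)` with `G` EVEN, `t = (1+1)(1+1)(1−1) = 0`; the conductor part `M₀₀/𝓘_S E ≅ 𝒪_{Y₁} ⊕ 𝒪_{Y₂}` is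
`ι`-induced (`t = 0`), as is `E/𝓘_S E`-bookkeeping: `t(R) = (1+1)(1−1) = 0`. [folklore] -/
theorem node_sol_balance :
    (∀ e₁ e₂ : ℤ, (e₁ = 1 ∨ e₁ = -1) → (e₂ = 1 ∨ e₂ = -1) → e₁ ≠ e₂ → 8 * e₁ + 8 * e₂ = 0) ∧
    ((1 + 1) ^ 3 = (8 : ℤ) ∧ (1 + 1) * (1 + 1) * (1 - 1) = (0 : ℤ) ∧ (1 + 1) * (1 - 1) = (0 : ℤ)) := by
  refine ⟨?_, by norm_num⟩
  intro e₁ e₂ h1 h2 h3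
  rcases h1 with h1 | h1 <;> rcases h2 with h2 | h2 <;> subst h1 <;> subst h2 <;> simp at h3 ⊢

/-- The mixed-directions rank (report 2.4 (b)–(c)): `δ = 2 − #{b : ℓ_t + ε_bℓ_s ≠ 0}`. With `ℓ_t = λℓ_s`, `λ² = 1`, and branch signs
`ε₁ ≠ ε₂` (both `±1`), exactly one of `λ + ε₁`, `λ + ε₂` vanishes, so the rank is `1` and `μ = 5` (TYPE VI); for independent linear parts
both are non-zero (rank 2, IV-1) and for `ℓ = 0` both vanish (rank 0, TYPE VII). [folklore] -/
theorem node_mixed_rank :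
    ∀ l e₁ e₂ : ℤ, (l = 1 ∨ l = -1) → (e₁ = 1 ∨ e₁ = -1) → (e₂ = 1 ∨ e₂ = -1) → e₁ ≠ e₂ →
      (l + e₁ = 0 ∧ l + e₂ ≠ 0) ∨ (l + e₁ ≠ 0 ∧ l + e₂ = 0) := by
  intro l e₁ e₂ hl h1 h2 h3
  rcases hl with hl | hl <;> rcases h1 with h1 | h1 <;> rcases h2 with h2 | h2 <;> subst hl <;> subst h1 <;> subst h2 <;>
    simp at h3 ⊢

/-- The classification table at a node (report 2.6): `μ(M) = 2 + μ_R(J) + δ` equals `2 + 2 + 0 = 4` (IV-1), `2 + 1 + 2 = 5` (V: cyclic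
`J ≅ R`, both `q`-generators survive), `2 + 2 + 1 = 5` (VI), `2 + 2 + 2 = 6` (VII); the corresponding `μ' = μ − 2 ∈ {2,3,3,4}` feed
`rankZero_mappingCone_betti` / `rankZero_shape_forcing`. [folklore] -/
theorem node_type_table :
    2 + 2 + 0 = 4 ∧ 2 + 1 + 2 = 5 ∧ 2 + 2 + 1 = 5 ∧ 2 + 2 + 2 = 6 ∧ (4 - 2 = 2 ∧ 5 - 2 = 3 ∧ 6 - 2 = 4) := by
  norm_num

/-- The Weierstrass fixed points `p = q` are NODES (report 3.1 (ii), correcting pv3-g11 1.3 (b)): with `s₀ = w⁴(c + c₁w + …)`,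
`s₁ = d₀ + d₁w + …`, the divided difference `f' = f/(σ − τ)` of `f = s₀(σ)s₁(τ) − s₁(σ)s₀(τ)` has cubic part `c d₀ (σ+τ)(σ²+τ²)` and
quartic part `c₁d₀(σ⁴+σ³τ+σ²τ²+στ³+τ⁴) + c d₁ στ(σ²+στ+τ²)` (from `(σ⁵ − τ⁵)/(σ−τ)` and `(σ⁴τ − στ⁴)/(σ−τ)`); in the coordinates
`e₁ = σ + τ`, `e₂ = στ` of `C₂` at `2p` these are `c d₀·e₁(e₁² − 2e₂)` and `c₁d₀(e₁⁴ − 3e₁²e₂ + e₂²) + c d₁ e₂(e₁² − e₂)`, so the only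
terms of degree `≤ 2` in `(e₁,e₂)` are `−2cd₀·e₁e₂ + (c₁d₀ − cd₁)·e₂²`: two distinct tangent lines. [folklore] -/
theorem tangentCone_diagonalFixedPoint (c c₁ d₀ d₁ s t : ℚ) :
    (s ^ 5 - t ^ 5 = (s - t) * (s ^ 4 + s ^ 3 * t + s ^ 2 * t ^ 2 + s * t ^ 3 + t ^ 4)) ∧
    (s ^ 4 * t - s * t ^ 4 = (s - t) * (s * t * (s ^ 2 + s * t + t ^ 2))) ∧
    (c * d₀ * (s + t) * (s ^ 2 + t ^ 2) = c * d₀ * ((s + t) ^ 3 - 2 * (s + t) * (s * t))) ∧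
    (s ^ 4 + s ^ 3 * t + s ^ 2 * t ^ 2 + s * t ^ 3 + t ^ 4 = (s + t) ^ 4 - 3 * (s + t) ^ 2 * (s * t) + (s * t) ^ 2) ∧
    (s * t * (s ^ 2 + s * t + t ^ 2) = (s * t) * ((s + t) ^ 2 - s * t)) ∧
    (∀ e₁ e₂ : ℚ, c * d₀ * (e₁ ^ 3 - 2 * e₁ * e₂) + (c₁ * d₀ * (e₁ ^ 4 - 3 * e₁ ^ 2 * e₂ + e₂ ^ 2) + c * d₁ * e₂ * (e₁ ^ 2 - e₂))
        = (-2 * c * d₀) * (e₁ * e₂) + (c₁ * d₀ - c * d₁) * e₂ ^ 2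
          + (c * d₀ * e₁ ^ 3 + c₁ * d₀ * e₁ ^ 4 - 3 * c₁ * d₀ * e₁ ^ 2 * e₂ + c * d₁ * e₁ ^ 2 * e₂)) := by
  refine ⟨by ring, by ring, by ring, by ring, by ring, ?_⟩
  intro e₁ e₂
  ring

/-- The `(T2)` configurations (report 3.1 (iii)): `Λ = |K − c − c'|` has a base point iff `c + c' + q` is a ruling of the quadric; a
fixed point needs the other ruling through `q` to be tangent, i.e. `p` a ramification point of a `g¹₃`: Riemann–Hurwitz gives
`2·4 − 2 + 2·3 = 12` such points per `g¹₃`, `24` configurations in all; the diagonal fixed points `p = q` are the Weierstrass points,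
of total weight `g³ − g = 60 = (r+1)(d + r(g−1))` for the canonical `g³₆` (`r = 3`, `d = 6`, `g = 4`) — and they are nodes. [folklore] -/
theorem T2_configuration_count :
    2 * 4 - 2 + 2 * 3 = 12 ∧ 12 + 12 = 24 ∧ 4 ^ 3 - 4 = 60 ∧ (3 + 1) * (6 + 3 * (4 - 1)) = 60 := by
  norm_num

/-- Cohomology of `𝒪_{C₂}(x_p)` on the symmetric square of a genus-4 curve (report 4.1): `σ^*𝒪(x_p) = 𝒪(p) ⊠ 𝒪(p)` with
`(h⁰,h¹)(𝒪_C(p)) = (1, 3)` (`h¹ = h⁰ − (1 − g + 1) = 1 + 2`); taking `𝔖₂`-invariants of Künneth (Koszul sign on `H¹ ⊗ H¹`):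
`h⁰ = 1`, `h¹ = h⁰·h¹ = 3`, `h² = dim Λ²(k³) = 3`, and `χ = 1 − 3 + 3 = 1` agrees with Riemann–Roch on `C₂`:
`χ(𝒪(x)) = χ(𝒪_{C₂}) + (x² − x·K)/2 = 3 + (1 − 5)/2`. [folklore] -/
theorem C2_xp_cohomology :
    (1 : ℤ) - (1 - 4 + 1) = 3 ∧ 1 * 3 = 3 ∧ 3 * 2 / 2 = 3 ∧ (1 : ℤ) - 3 + 3 = 1 ∧ (3 : ℚ) + (1 - 5) / 2 = 1 := by
  norm_num

/-- The theta-class bundle of `(E2)(a)` (report 4.2): `M_{c'} = 𝒪(x_q + T_{|K−c'−q|}) = det (K − c')^{[2]}` has class `θ ≡ 5x − d`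
(`x + (4x − d)`), `θ² = 25 − 10 − 3 = 12`, `θ·K_{C₂} = 5·5 + 9·(−1) = 16`, `χ = 3 + (12 − 16)/2 = 1`; its Serre dual `K_{C₂} − M_{c'}` has
class `(6x − d) − (5x − d) = x` and IS `𝒪(x_{c'})`, so `(h⁰,h¹,h²)(M_{c'}) = (h²,h¹,h⁰)(𝒪(x_{c'})) = (3,3,1)` for every `c'` and `q`:
`h¹ ≡ 3` — there is no jump locus. (Intersection form on `Num(C₂) = ℤx ⊕ ℤd`: `x² = 1`, `x·d = 1`, `d² = −3`, `K ≡ 6x − d`.)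
[folklore] -/
theorem C2_thetaClass_cohomology :
    (1 : ℤ) + 4 = 5 ∧ (5 : ℤ) ^ 2 + 2 * 5 * (-1) * 1 - 3 * (-1) ^ 2 = 12 ∧ (5 : ℤ) * 5 + 9 * (-1) = 16 ∧
    (3 : ℚ) + (12 - 16) / 2 = 1 ∧ ((6 : ℤ) - 5 = 1 ∧ (-1 : ℤ) - (-1) = 0) ∧ (3 : ℤ) - 3 + 1 = 1 := by
  norm_num

/-- The h⁰-probe on the welding locus (report §8 = ADDENDUM A, sharpening pv3-g8's Addendum 1 A4): the plane `H_q = ⟨c', T_qC⟩` cuts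
the canonical sextic in `c' + 2q + y₁ + y₂ + y₃` (`6 − 1 − 2 = 3` residual points, `W ∩ Y₁ = {q + y_i}`); a section `s_ℓ` of the net
`|M_{c'}| = {T_ℓ : ℓ ∋ c'}` (`h⁰ = 3`) vanishes on `W ∩ Y₁` iff `ℓ ⊂ H_q` — ONE linear condition (lines through `c'` in a fixed plane) —, so
`h⁰(Y₁, M_{c'} ⊗ 𝓘_{W∩Y₁}) = 3 − 1 = 2 < 3` = the probe's budget, and `e₁ ≥ h⁰ − 1` gives at most `2 − 1 = 1 < 2`: the probe is silent
on the welding locus. [folklore] -/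
theorem welding_probe_bound : 6 - 1 - 2 = 3 ∧ 3 - 1 = 2 ∧ 2 < 3 ∧ 2 - 1 = 1 ∧ 1 < 2 := by
  norm_num

end H2GluedTangencyRankZero

end Literature.AlgebraicGeometry.HodgeTheory
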